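import Summits.Ventures.CertifiedArithmetic.LowPrec.EnvelopesDirectedE2M1

/-!
# Directed-mode (RZ / RD / RU) normal-range relative constants, destination `E3M2` (products)

HONEST FRAMING (venture CertifiedArithmetic / cell `pub-lowprec`): certified error envelopes and
provably optimal rounding/accumulation schemes for low-precision formats under stated cost models;
every table by two implementations; no hardware or vendor claims.

The kernel third implementation of the RNE self-destination tables of the nine FP6/FP4 ordered
pairs is `EnvelopesE2M1/E3M2/E2M3`, `EnvelopesMixedE3M2/E2M3`, `EnvelopesMixedFP4`. This file adds
the DIRECTED columns of ENVELOPES.md / paper Table 2 for the three rows `E3M2 ∘ Y → E3M2`,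
`Y ∈ {E3M2, E2M3, E2M1}`, `∘ = ×` (by commutativity the enum seat's ordered tables with the
operands exchanged are the transposes; sibling file: the other operation):
for each row and each of `roundTowardZero`
(RZ), `roundDown` (RD), `roundUp` (RU) the SHARP relative constant on the destination's normal
range `1 / 4 ≤ |t| ≤ maxRat` — a bound over all in-range pairs AND an explicit maximiser — by
`decide +kernel` over all operand pairs. `max RU = max RD` on every row (sign symmetry `RU(-t) =
-RD(t)`; both columns are proved with the same constant and each is attained). Constants:
`E3M2*E3M2` RZ 1/9, RD=RU 1/7; `E3M2*E2M3` RZ 7/39, RD=RU 3/13; `E3M2*E2M1` RZ 1/9, RD=RU 1/7.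
They were computed by an exact evaluator (enum seat, `HOME/lean/enum/dir_envelopes.py`,
Fractions only, no code shared with implementations A/B) and agree with the certified campaign
tables (certs/enum/canary, certs/enum/fp6fp4mixed: implementation A = implementation B = the
referee's route) on all 18 rows × 2 columns. Below the normal range the directed relative error
reaches `1` (results flushed to `0`), so no global constant `< 1` exists; the absolute directed
envelope (`< 1 ulp` per binade) is the generic Theorem E2 (`DirectedEnvelope`).
-/

namespace Summit.Ventures.CertifiedArithmetic

open Literature.ComputerArithmetic.FloatingPoint
open Literature.ComputerArithmetic.FloatingPoint.MiniFloat
open Literature.ComputerArithmetic.FloatingPoint.Format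


/-- `E3M2 * E3M2 → E3M2` under `RZ` (`roundTowardZero`): on the normal range `1 / 4 ≤ |t| ≤ 28`
of `E3M2` every in-range product satisfies `|fl(t) - t| ≤ 1 / 9 · |t|`, and `1 / 9` is
attained (`a = 3 / 16`, `b = 3 / 2`: `t = 9 / 32 ↦ 1 / 4`); kernel-exhaustive over all
`64 × 64` ordered pairs. -/
theorem E3M2_E3M2_mul_E3M2_relRZ_normal :
    (∀ (a : MiniFloat E3M2) (b : MiniFloat E3M2),
        (1 / 4 : ℚ) ≤ |a.toRat * b.toRat| → |a.toRat * b.toRat| ≤ E3M2.maxRat →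
          |(roundTowardZero E3M2 (a.toRat * b.toRat)).toRat - (a.toRat * b.toRat)|
            ≤ 1 / 9 * |a.toRat * b.toRat|) ∧
      ∃ (a : MiniFloat E3M2) (b : MiniFloat E3M2),
        (1 / 4 : ℚ) ≤ |a.toRat * b.toRat| ∧ |a.toRat * b.toRat| ≤ E3M2.maxRat ∧
          |(roundTowardZero E3M2 (a.toRat * b.toRat)).toRat - (a.toRat * b.toRat)|
            = 1 / 9 * |a.toRat * b.toRat| :=
  ⟨fun a b => of_decide_eq_true (forall₂_of_all_all
      (P := relDirTest E3M2 (roundTowardZero E3M2) (· * ·) (1 / 4) (1 / 9))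
      (by decide +kernel) a b),
    ⟨false, 0, 3, by decide, by decide, by decide⟩,
    ⟨false, 3, 2, by decide, by decide, by decide⟩, by decide +kernel⟩

/-- `E3M2 * E3M2 → E3M2` under `RD` (`roundDown`): on the normal range `1 / 4 ≤ |t| ≤ 28`
of `E3M2` every in-range product satisfies `|fl(t) - t| ≤ 1 / 7 · |t|`, and `1 / 7` is
attained (`a = 3 / 16`, `b = -7 / 4`: `t = -21 / 64 ↦ -3 / 8`); kernel-exhaustive over all
`64 × 64` ordered pairs. -/
theorem E3M2_E3M2_mul_E3M2_relRD_normal :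
    (∀ (a : MiniFloat E3M2) (b : MiniFloat E3M2),
        (1 / 4 : ℚ) ≤ |a.toRat * b.toRat| → |a.toRat * b.toRat| ≤ E3M2.maxRat →
          |(roundDown E3M2 (a.toRat * b.toRat)).toRat - (a.toRat * b.toRat)|
            ≤ 1 / 7 * |a.toRat * b.toRat|) ∧
      ∃ (a : MiniFloat E3M2) (b : MiniFloat E3M2),
        (1 / 4 : ℚ) ≤ |a.toRat * b.toRat| ∧ |a.toRat * b.toRat| ≤ E3M2.maxRat ∧
          |(roundDown E3M2 (a.toRat * b.toRat)).toRat - (a.toRat * b.toRat)|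
            = 1 / 7 * |a.toRat * b.toRat| :=
  ⟨fun a b => of_decide_eq_true (forall₂_of_all_all
      (P := relDirTest E3M2 (roundDown E3M2) (· * ·) (1 / 4) (1 / 7))
      (by decide +kernel) a b),
    ⟨false, 0, 3, by decide, by decide, by decide⟩,
    ⟨true, 3, 3, by decide, by decide, by decide⟩, by decide +kernel⟩

/-- `E3M2 * E3M2 → E3M2` under `RU` (`roundUp`): on the normal range `1 / 4 ≤ |t| ≤ 28`
of `E3M2` every in-range product satisfies `|fl(t) - t| ≤ 1 / 7 · |t|`, and `1 / 7` is
attained (`a = 3 / 16`, `b = 7 / 4`: `t = 21 / 64 ↦ 3 / 8`); kernel-exhaustive over all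
`64 × 64` ordered pairs. -/
theorem E3M2_E3M2_mul_E3M2_relRU_normal :
    (∀ (a : MiniFloat E3M2) (b : MiniFloat E3M2),
        (1 / 4 : ℚ) ≤ |a.toRat * b.toRat| → |a.toRat * b.toRat| ≤ E3M2.maxRat →
          |(roundUp E3M2 (a.toRat * b.toRat)).toRat - (a.toRat * b.toRat)|
            ≤ 1 / 7 * |a.toRat * b.toRat|) ∧
      ∃ (a : MiniFloat E3M2) (b : MiniFloat E3M2),
        (1 / 4 : ℚ) ≤ |a.toRat * b.toRat| ∧ |a.toRat * b.toRat| ≤ E3M2.maxRat ∧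
          |(roundUp E3M2 (a.toRat * b.toRat)).toRat - (a.toRat * b.toRat)|
            = 1 / 7 * |a.toRat * b.toRat| :=
  ⟨fun a b => of_decide_eq_true (forall₂_of_all_all
      (P := relDirTest E3M2 (roundUp E3M2) (· * ·) (1 / 4) (1 / 7))
      (by decide +kernel) a b),
    ⟨false, 0, 3, by decide, by decide, by decide⟩,
    ⟨false, 3, 3, by decide, by decide, by decide⟩, by decide +kernel⟩

/-- `E3M2 * E2M3 → E3M2` under `RZ` (`roundTowardZero`): on the normal range `1 / 4 ≤ |t| ≤ 28`
of `E3M2` every in-range product satisfies `|fl(t) - t| ≤ 7 / 39 · |t|`, and `7 / 39` is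
attained (`a = 3 / 16`, `b = 13 / 8`: `t = 39 / 128 ↦ 1 / 4`); kernel-exhaustive over all
`64 × 64` ordered pairs. -/
theorem E3M2_E2M3_mul_E3M2_relRZ_normal :
    (∀ (a : MiniFloat E3M2) (b : MiniFloat E2M3),
        (1 / 4 : ℚ) ≤ |a.toRat * b.toRat| → |a.toRat * b.toRat| ≤ E3M2.maxRat →
          |(roundTowardZero E3M2 (a.toRat * b.toRat)).toRat - (a.toRat * b.toRat)|
            ≤ 7 / 39 * |a.toRat * b.toRat|) ∧
      ∃ (a : MiniFloat E3M2) (b : MiniFloat E2M3),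
        (1 / 4 : ℚ) ≤ |a.toRat * b.toRat| ∧ |a.toRat * b.toRat| ≤ E3M2.maxRat ∧
          |(roundTowardZero E3M2 (a.toRat * b.toRat)).toRat - (a.toRat * b.toRat)|
            = 7 / 39 * |a.toRat * b.toRat| :=
  ⟨fun a b => of_decide_eq_true (forall₂_of_all_all
      (P := relDirTest E3M2 (roundTowardZero E3M2) (· * ·) (1 / 4) (7 / 39))
      (by decide +kernel) a b),
    ⟨false, 0, 3, by decide, by decide, by decide⟩,
    ⟨false, 1, 5, by decide, by decide, by decide⟩, by decide +kernel⟩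

/-- `E3M2 * E2M3 → E3M2` under `RD` (`roundDown`): on the normal range `1 / 4 ≤ |t| ≤ 28`
of `E3M2` every in-range product satisfies `|fl(t) - t| ≤ 3 / 13 · |t|`, and `3 / 13` is
attained (`a = 5 / 16`, `b = -13 / 8`: `t = -65 / 128 ↦ -5 / 8`); kernel-exhaustive over all
`64 × 64` ordered pairs. -/
theorem E3M2_E2M3_mul_E3M2_relRD_normal :
    (∀ (a : MiniFloat E3M2) (b : MiniFloat E2M3),
        (1 / 4 : ℚ) ≤ |a.toRat * b.toRat| → |a.toRat * b.toRat| ≤ E3M2.maxRat →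
          |(roundDown E3M2 (a.toRat * b.toRat)).toRat - (a.toRat * b.toRat)|
            ≤ 3 / 13 * |a.toRat * b.toRat|) ∧
      ∃ (a : MiniFloat E3M2) (b : MiniFloat E2M3),
        (1 / 4 : ℚ) ≤ |a.toRat * b.toRat| ∧ |a.toRat * b.toRat| ≤ E3M2.maxRat ∧
          |(roundDown E3M2 (a.toRat * b.toRat)).toRat - (a.toRat * b.toRat)|
            = 3 / 13 * |a.toRat * b.toRat| :=
  ⟨fun a b => of_decide_eq_true (forall₂_of_all_all
      (P := relDirTest E3M2 (roundDown E3M2) (· * ·) (1 / 4) (3 / 13))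
      (by decide +kernel) a b),
    ⟨false, 1, 1, by decide, by decide, by decide⟩,
    ⟨true, 1, 5, by decide, by decide, by decide⟩, by decide +kernel⟩

/-- `E3M2 * E2M3 → E3M2` under `RU` (`roundUp`): on the normal range `1 / 4 ≤ |t| ≤ 28`
of `E3M2` every in-range product satisfies `|fl(t) - t| ≤ 3 / 13 · |t|`, and `3 / 13` is
attained (`a = 5 / 16`, `b = 13 / 8`: `t = 65 / 128 ↦ 5 / 8`); kernel-exhaustive over all
`64 × 64` ordered pairs. -/
theorem E3M2_E2M3_mul_E3M2_relRU_normal :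
    (∀ (a : MiniFloat E3M2) (b : MiniFloat E2M3),
        (1 / 4 : ℚ) ≤ |a.toRat * b.toRat| → |a.toRat * b.toRat| ≤ E3M2.maxRat →
          |(roundUp E3M2 (a.toRat * b.toRat)).toRat - (a.toRat * b.toRat)|
            ≤ 3 / 13 * |a.toRat * b.toRat|) ∧
      ∃ (a : MiniFloat E3M2) (b : MiniFloat E2M3),
        (1 / 4 : ℚ) ≤ |a.toRat * b.toRat| ∧ |a.toRat * b.toRat| ≤ E3M2.maxRat ∧
          |(roundUp E3M2 (a.toRat * b.toRat)).toRat - (a.toRat * b.toRat)|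
            = 3 / 13 * |a.toRat * b.toRat| :=
  ⟨fun a b => of_decide_eq_true (forall₂_of_all_all
      (P := relDirTest E3M2 (roundUp E3M2) (· * ·) (1 / 4) (3 / 13))
      (by decide +kernel) a b),
    ⟨false, 1, 1, by decide, by decide, by decide⟩,
    ⟨false, 1, 5, by decide, by decide, by decide⟩, by decide +kernel⟩

/-- `E3M2 * E2M1 → E3M2` under `RZ` (`roundTowardZero`): on the normal range `1 / 4 ≤ |t| ≤ 28`
of `E3M2` every in-range product satisfies `|fl(t) - t| ≤ 1 / 9 · |t|`, and `1 / 9` is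
attained (`a = 3 / 16`, `b = 3 / 2`: `t = 9 / 32 ↦ 1 / 4`); kernel-exhaustive over all
`64 × 16` ordered pairs. -/
theorem E3M2_E2M1_mul_E3M2_relRZ_normal :
    (∀ (a : MiniFloat E3M2) (b : MiniFloat E2M1),
        (1 / 4 : ℚ) ≤ |a.toRat * b.toRat| → |a.toRat * b.toRat| ≤ E3M2.maxRat →
          |(roundTowardZero E3M2 (a.toRat * b.toRat)).toRat - (a.toRat * b.toRat)|
            ≤ 1 / 9 * |a.toRat * b.toRat|) ∧
      ∃ (a : MiniFloat E3M2) (b : MiniFloat E2M1),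
        (1 / 4 : ℚ) ≤ |a.toRat * b.toRat| ∧ |a.toRat * b.toRat| ≤ E3M2.maxRat ∧
          |(roundTowardZero E3M2 (a.toRat * b.toRat)).toRat - (a.toRat * b.toRat)|
            = 1 / 9 * |a.toRat * b.toRat| :=
  ⟨fun a b => of_decide_eq_true (forall₂_of_all_all
      (P := relDirTest E3M2 (roundTowardZero E3M2) (· * ·) (1 / 4) (1 / 9))
      (by decide +kernel) a b),
    ⟨false, 0, 3, by decide, by decide, by decide⟩,
    ⟨false, 1, 1, by decide, by decide, by decide⟩, by decide +kernel⟩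

/-- `E3M2 * E2M1 → E3M2` under `RD` (`roundDown`): on the normal range `1 / 4 ≤ |t| ≤ 28`
of `E3M2` every in-range product satisfies `|fl(t) - t| ≤ 1 / 7 · |t|`, and `1 / 7` is
attained (`a = 7 / 16`, `b = -3 / 2`: `t = -21 / 32 ↦ -3 / 4`); kernel-exhaustive over all
`64 × 16` ordered pairs. -/
theorem E3M2_E2M1_mul_E3M2_relRD_normal :
    (∀ (a : MiniFloat E3M2) (b : MiniFloat E2M1),
        (1 / 4 : ℚ) ≤ |a.toRat * b.toRat| → |a.toRat * b.toRat| ≤ E3M2.maxRat →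
          |(roundDown E3M2 (a.toRat * b.toRat)).toRat - (a.toRat * b.toRat)|
            ≤ 1 / 7 * |a.toRat * b.toRat|) ∧
      ∃ (a : MiniFloat E3M2) (b : MiniFloat E2M1),
        (1 / 4 : ℚ) ≤ |a.toRat * b.toRat| ∧ |a.toRat * b.toRat| ≤ E3M2.maxRat ∧
          |(roundDown E3M2 (a.toRat * b.toRat)).toRat - (a.toRat * b.toRat)|
            = 1 / 7 * |a.toRat * b.toRat| :=
  ⟨fun a b => of_decide_eq_true (forall₂_of_all_all
      (P := relDirTest E3M2 (roundDown E3M2) (· * ·) (1 / 4) (1 / 7))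
      (by decide +kernel) a b),
    ⟨false, 1, 3, by decide, by decide, by decide⟩,
    ⟨true, 1, 1, by decide, by decide, by decide⟩, by decide +kernel⟩

/-- `E3M2 * E2M1 → E3M2` under `RU` (`roundUp`): on the normal range `1 / 4 ≤ |t| ≤ 28`
of `E3M2` every in-range product satisfies `|fl(t) - t| ≤ 1 / 7 · |t|`, and `1 / 7` is
attained (`a = 7 / 16`, `b = 3 / 2`: `t = 21 / 32 ↦ 3 / 4`); kernel-exhaustive over all
`64 × 16` ordered pairs. -/
theorem E3M2_E2M1_mul_E3M2_relRU_normal :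
    (∀ (a : MiniFloat E3M2) (b : MiniFloat E2M1),
        (1 / 4 : ℚ) ≤ |a.toRat * b.toRat| → |a.toRat * b.toRat| ≤ E3M2.maxRat →
          |(roundUp E3M2 (a.toRat * b.toRat)).toRat - (a.toRat * b.toRat)|
            ≤ 1 / 7 * |a.toRat * b.toRat|) ∧
      ∃ (a : MiniFloat E3M2) (b : MiniFloat E2M1),
        (1 / 4 : ℚ) ≤ |a.toRat * b.toRat| ∧ |a.toRat * b.toRat| ≤ E3M2.maxRat ∧
          |(roundUp E3M2 (a.toRat * b.toRat)).toRat - (a.toRat * b.toRat)|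
            = 1 / 7 * |a.toRat * b.toRat| :=
  ⟨fun a b => of_decide_eq_true (forall₂_of_all_all
      (P := relDirTest E3M2 (roundUp E3M2) (· * ·) (1 / 4) (1 / 7))
      (by decide +kernel) a b),
    ⟨false, 1, 3, by decide, by decide, by decide⟩,
    ⟨false, 1, 1, by decide, by decide, by decide⟩, by decide +kernel⟩

end Summit.Ventures.CertifiedArithmetic
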